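import Summits.ABC.IUTFork.LDHSUnitFamilyPoles
import Summits.ABC.IUTFork.LDHSUnitFamilyCompact
import Literature.IUT.LogVolume.Corollary22PartIIPointwise
import Literature.IUT.LogVolume.Theorem110RealStepII
import Mathlib.NumberTheory.NumberField.Norm
import HarnessLib

/-!
# The S-unit quadratic family of the `λ`-line: III. The points `P_{a,c} = (F_{a,c}, λ_{a,c})` are ADMISSIBLE at a
# FIXED prime `l` (`l ∤ a`, `l ∤ c`, `l ∉ {2,5,7}`): `P ∈ UP`, `d_mod = 2`, core, (P2), (P5), `log q^∀ ≥ a·log 5`,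
# `log 𝔣 ≤ ½(log 5 + 2 log 7)`, `log-diff ≤ ½ log D`, all conjugates in `K_∞(R)`

Record-only PROOF file (D-0012) of the abc-iut cell (R2 S-chain team, seat abc-iut-s2-p4 gen 4); TAKES NO SIDE on [IUTchIII] Cor.
3.12 or [IUTchIV] Thm. 1.10. S. Mochizuki, *IUT IV* [Mochizuki2012], Cor. 2.2 (ii) proof (P1)–(P7) pp. 45–46 ((P2): "`l` does not
divide any nonzero `h_v`"; (P5): "`𝕍^bad_mod ≠ ∅`"; "admits an `F`-core": `j ∉` the four exceptional values); [MochizukiGenEll2010]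
Def. 1.5 p. 8 (`F_min`, `log-diff`), Ex. 1.3 (ii) p. 5; Dupuy–Hilado [DupuyHilado2025] §3.3, §3.6.

For `a, c ≥ 1` the point `P = (F_{a,c}, λ_{a,c})` of parts I–IIb satisfies, IN THE KERNEL and at a FIXED prime `l`:
* `λ ∉ ℚ`, `j(λ) ∉ ℚ` (split valuations over the MIXED prime `5`: `ord_{𝔭₁} < 0 ≤ ord_{𝔭₂}`), hence `P ∈ UP`, `ℚ(j(λ)) = F`, `d_mod(P) = 2`,
  `AdmitsCore P`;
* `Cor22.CondP2 P l` for every prime `l ∤ 2a`, `l ∤ 2c` (the poles have orders `−2a, −2c, −2c`); `Cor22.CondP5 P l` for `l ≠ 5`;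
* `a·log 5 ≤ log q^∀(P)`; `Cor22.logCondAvoid P S ≤ (log 5 + 2·log 7)/2` for every `S`; `P.logDiff ≤ (log D)/2`
  (`δ = f′(θ) ∈ 𝔡_F`, `|N(δ)| = D = 5^{2a} + 4·7^{2c}`, Dedekind);
* every complex conjugate of `λ` is a root of `z² − (2 + r)z + r`, `r = 5^a/7^c`, so `P ∈ K_∞(R)` whenever `1 ≤ r ≤ R`
  (`LDHSUnitFamilyCompact.root_mem_twoDiscs`).
Elementary; (P6) is NOT proved here (it follows above a height `H_K` from the tree's PROVED (P4) ⟹ (P6), used in part IV).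
Nothing asserted about Θ-data; no side taken. [cite: Mochizuki2012, IUTchIV Cor 2.2 (ii) proof (P1)-(P7) pp.45-46]
[cite: MochizukiGenEll2010, Def 1.5 p.8] [cite: DupuyHilado2025, §3.3, §3.6] [claim: Mochizuki2012, status: disputed] for IUT locators.
-/

noncomputable section

namespace Summit.ABC.IUTFork.SUnitFamily

open NumberField IsDedekindDomain Polynomial Literature.IUT.LogVolume Literature.IUT.LogVolume.Cor22
open Literature.NumberTheory.DiophantineGeometry.GenEll

/-- The point `P_{a,c}` as a REDUCIBLE structure literal (so that `(Pt a c).F` unfolds to `F a c` during instance search);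
`Pt a c = Pt a c` definitionally (`Pt_eq`). [cite: MochizukiGenEll2010, Ex 1.3 (ii) p.5] -/
abbrev Pt (a c : ℕ) : NFPoint := ⟨F a c, lam a c⟩

/-- `Pt a c` is part I's `P a c`. [cite: MochizukiGenEll2010, Ex 1.3 (ii) p.5] -/
theorem Pt_eq (a c : ℕ) : Pt a c = P a c := rfl

/-! ## The four distinguished places (for `a, c ≥ 1`) -/

/-- **The places `𝔭₁, 𝔭₂ ∣ 5` and `𝔮₁, 𝔮₂ ∣ 7`** with `θ ∈ 𝔭₁, 𝔮₁`, `θ ∉ 𝔭₂, 𝔮₂`, `θ' ∈ 𝔭₂, 𝔮₂`, `θ' ∉ 𝔭₁, 𝔮₁`, and `ord 5 = 1`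
on `𝔭₁, 𝔭₂`, `ord 7 = 1` on `𝔮₁, 𝔮₂` (`a, c ≥ 1`). [cite: NeukirchANT1999, Ch. I §8] -/
theorem exists_four_places {a c : ℕ} (ha : 1 ≤ a) (hc : 1 ≤ c) :
    ∃ 𝔭₁ 𝔭₂ 𝔮₁ 𝔮₂ : HeightOneSpectrum (𝓞 (F a c)),
      (θI a c ∈ 𝔭₁.asIdeal ∧ θI' a c ∉ 𝔭₁.asIdeal ∧ ((5 : ℕ) : 𝓞 (F a c)) ∈ 𝔭₁.asIdeal ∧ ord (F a c) 𝔭₁ (5 : F a c) = 1) ∧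
      (θI a c ∉ 𝔭₂.asIdeal ∧ θI' a c ∈ 𝔭₂.asIdeal ∧ ((5 : ℕ) : 𝓞 (F a c)) ∈ 𝔭₂.asIdeal ∧ ord (F a c) 𝔭₂ (5 : F a c) = 1) ∧
      (θI a c ∈ 𝔮₁.asIdeal ∧ θI' a c ∉ 𝔮₁.asIdeal ∧ ((7 : ℕ) : 𝓞 (F a c)) ∈ 𝔮₁.asIdeal ∧ ord (F a c) 𝔮₁ (7 : F a c) = 1) ∧
      (θI a c ∉ 𝔮₂.asIdeal ∧ θI' a c ∈ 𝔮₂.asIdeal ∧ ((7 : ℕ) : 𝓞 (F a c)) ∈ 𝔮₂.asIdeal ∧ ord (F a c) 𝔮₂ (7 : F a c) = 1) := by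
  haveI : Fact (Nat.Prime 5) := ⟨by norm_num⟩
  haveI : Fact (Nat.Prime 7) := ⟨by norm_num⟩
  obtain ⟨𝔭₁, 𝔭₂, h1, h2, h3, h4, h5, h6⟩ :=
    exists_places a c (p := 5) (Dvd.dvd.mul_right (dvd_pow_self 5 (by omega)) _) (not_dvd_s.1 ha)
  obtain ⟨𝔮₁, 𝔮₂, k1, k2, k3, k4, k5, k6⟩ :=
    exists_places a c (p := 7) (Dvd.dvd.mul_left (dvd_pow_self 7 (by omega)) _) (not_dvd_s.2 hc)
  -- `ord 5 = 1` at both places over `5`: local degrees are `1`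
  have hd5 := localDegree_pair_eq_one (p := 5) h1 h3 h5 h6
  have hd7 := localDegree_pair_eq_one (p := 7) k1 k3 k5 k6
  have hord : ∀ (p : ℕ) [Fact p.Prime] (v : HeightOneSpectrum (𝓞 (F a c))), ((p : ℕ) : 𝓞 (F a c)) ∈ v.asIdeal →
      localDegree (F a c) v = 1 → ord (F a c) v (p : F a c) = 1 := by
    intro p _ v hp hd
    rw [ord_natCast_eq_ramIdx p v (mem_placesOver_of_natCast_mem p v hp)]
    unfold localDegree at hd
    exact_mod_cast Nat.eq_one_of_mul_eq_one_right hd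
  exact ⟨𝔭₁, 𝔭₂, 𝔮₁, 𝔮₂, ⟨h1, h4, h5, by exact_mod_cast hord 5 𝔭₁ h5 hd5.1⟩, ⟨h3, h2, h6, by exact_mod_cast hord 5 𝔭₂ h6 hd5.2⟩,
    ⟨k1, k4, k5, by exact_mod_cast hord 7 𝔮₁ k5 hd7.1⟩, ⟨k3, k2, k6, by exact_mod_cast hord 7 𝔮₂ k6 hd7.2⟩⟩

section Point

variable {a c : ℕ} (ha : 1 ≤ a) (hc : 1 ≤ c)
include ha hc

/-! ## Irrationality of `λ` and `j(λ)`; `P ∈ UP`, `ℚ(j(λ)) = F`, `d_mod = 2`, core -/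

/-- `j(λ) ∉ ℚ`: it has a pole at `𝔭₁` but not at `𝔭₂` (both over `5`). [cite: Mochizuki2012, IUTchIV Cor 2.2 (ii) proof p.46]
[claim: Mochizuki2012, status: disputed] -/
theorem jInv_not_mem_bot : jInv (lam a c) ∉ (⊥ : IntermediateField ℚ (F a c)) := by
  haveI : Fact (Nat.Prime 5) := ⟨by norm_num⟩
  obtain ⟨𝔭₁, 𝔭₂, -, -, ⟨h1, h1', h15, ho1⟩, ⟨h2, -, h25, -⟩, -, -⟩ := exists_four_places ha hc
  have hneg := (ord_at_p1 hc h15 h1 h1' ho1).1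
  have hnn := (ord_at_p2 hc h25 h2).1
  exact SplitDepth.not_mem_bot_of_ord_neg_of_ord_nonneg ⟨𝔭₁, mem_placesOver_of_natCast_mem 5 𝔭₁ h15⟩
    ⟨𝔭₂, mem_placesOver_of_natCast_mem 5 𝔭₂ h25⟩ (by rw [hneg]; omega) hnn

/-- `λ ∉ ℚ`: `ord_{𝔭₁} λ = a > 0 = ord_{𝔭₂} λ`. [cite: MochizukiGenEll2010, Def 1.5 p.8] -/
theorem lam_not_mem_bot : lam a c ∉ (⊥ : IntermediateField ℚ (F a c)) := by
  haveI : Fact (Nat.Prime 5) := ⟨by norm_num⟩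
  obtain ⟨𝔭₁, 𝔭₂, -, -, ⟨h1, h1', h15, ho1⟩, ⟨h2, -, h25, -⟩, -, -⟩ := exists_four_places ha hc
  have hpos := (ord_at_p1 hc h15 h1 h1' ho1).2
  have hzero := (ord_at_p2 hc h25 h2).2
  exact SplitDepth.not_mem_bot_of_ord_pos_of_ord_eq_zero ⟨𝔭₁, mem_placesOver_of_natCast_mem 5 𝔭₁ h15⟩
    ⟨𝔭₂, mem_placesOver_of_natCast_mem 5 𝔭₂ h25⟩ (by rw [hpos]; exact_mod_cast ha) hzero

/-- `ℚ(j(λ)) = F`. [cite: Mochizuki2012, IUTchIV Thm 1.10 p.22] [claim: Mochizuki2012, status: disputed] -/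
theorem adjoin_jInv_eq_top : IntermediateField.adjoin ℚ ({jInv (lam a c)} : Set (F a c)) = ⊤ :=
  SplitDepth.adjoin_simple_eq_top_of_not_mem_bot (finrank_F a c) (jInv_not_mem_bot ha hc)

/-- **`P_{a,c} ∈ UP`**: `λ ≠ 0, 1` and `ℚ(λ) = F`. [cite: MochizukiGenEll2010, Def 1.5 (i) p.8] -/
theorem P_mem_UP : Pt a c ∈ UP := by
  refine ⟨⟨?_, ?_⟩, SplitDepth.adjoin_simple_eq_top_of_not_mem_bot (finrank_F a c) (lam_not_mem_bot ha hc)⟩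
  · change lam a c ≠ 0
    unfold lam
    exact div_ne_zero (θ_ne_zero a c).1 (pow_ne_zero _ (by exact_mod_cast (show (7 : ℕ) ≠ 0 by norm_num)))
  · change lam a c ≠ 1
    intro h
    have := one_sub_lam_mul a c
    rw [h, sub_self, zero_mul] at this
    norm_num at this

/-- **`d_mod(P_{a,c}) = 2`**. [cite: Mochizuki2012, IUTchIV Thm 1.10 p.22] [claim: Mochizuki2012, status: disputed] -/
theorem dmod_P : dmod (Pt a c) = 2 := by
  change Module.finrank ℚ (IntermediateField.adjoin ℚ ({jInv (lam a c)} : Set (F a c))) = 2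
  rw [adjoin_jInv_eq_top ha hc, IntermediateField.finrank_top', finrank_F]

/-- **`AdmitsCore P_{a,c}`**: the four exceptional `j`-invariants are rational, `j(λ) ∉ ℚ`.
[cite: Mochizuki2012, IUTchIV Cor 2.2 (ii) proof p.43] [claim: Mochizuki2012, status: disputed] -/
theorem admitsCore_P : AdmitsCore (Pt a c) := by
  intro q _ h
  apply jInv_not_mem_bot ha hc
  rw [IntermediateField.mem_bot]
  change jInv (lam a c) = ((q : ℚ) : F a c) at h
  exact ⟨q, by rw [h, eq_ratCast]⟩

/-! ## (P2) at a fixed prime, (P5) -/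

/-- **(P2) at `P_{a,c}` for EVERY prime `l ≠ 2` with `l ∤ a`, `l ∤ c`** (the poles of `j(λ)` have orders `−2a`, `−2c`, `−2c`).
[cite: Mochizuki2012, IUTchIV Cor 2.2 (ii) proof (P2) p.45] [claim: Mochizuki2012, status: disputed] -/
theorem condP2_P {l : ℕ} (hl : l.Prime) (hl2 : l ≠ 2) (hla : ¬ l ∣ a) (hlc : ¬ l ∣ c) : CondP2 (Pt a c) l := by
  haveI : Fact (Nat.Prime 5) := ⟨by norm_num⟩
  haveI : Fact (Nat.Prime 7) := ⟨by norm_num⟩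
  obtain ⟨𝔭₁, 𝔭₂, 𝔮₁, 𝔮₂, ⟨h1, h1', h15, ho1⟩, ⟨h2, -, h25, -⟩, ⟨k1, k1', k17, ko1⟩, ⟨k2, -, k27, ko2⟩⟩ :=
    exists_four_places ha hc
  have hl2dvd : ∀ m : ℕ, ¬ l ∣ m → ¬ ((l : ℤ) ∣ -(2 * (m : ℤ))) := by
    intro m hm h
    rw [dvd_neg] at h
    have h' : l ∣ 2 * m := by exact_mod_cast h
    rcases (Nat.Prime.dvd_mul hl).mp h' with h2 | h2
    · exact hl2 ((Nat.prime_dvd_prime_iff_eq hl Nat.prime_two).mp h2)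
    · exact hm h2
  intro v hv
  -- `hv : ord_v j(λ) < 0` read over `F_{a,c}` (definitional unfolding of `P`)
  have hv' : ord (F a c) (v : HeightOneSpectrum (𝓞 (F a c))) (jInv (lam a c)) < 0 := hv
  rcases five_mem_or_seven_mem_of_ord_neg hc hv' with h5 | h7
  · have hmem : (v : HeightOneSpectrum (𝓞 (F a c))) ∈ placesOver (F a c) 5 := mem_placesOver_of_natCast_mem 5 _ h5
    rw [placesOver_eq_pair (p := 5) h1 h2 h15 h25] at hmem
    simp only [Finset.mem_insert, Finset.mem_singleton] at hmem
    rcases hmem with h | h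
    · have e : ord (Pt a c).F v (jInv (Pt a c).x) = -(2 * (a : ℤ)) := by
        have := (ord_at_p1 hc h15 h1 h1' ho1).1; rw [← h] at this; exact this
      rw [e]; exact hl2dvd a hla
    · have e : 0 ≤ ord (Pt a c).F v (jInv (Pt a c).x) := by
        have := (ord_at_p2 hc h25 h2).1; rw [← h] at this; exact this
      exact absurd e (not_le.mpr hv)
  · have hmem : (v : HeightOneSpectrum (𝓞 (F a c))) ∈ placesOver (F a c) 7 := mem_placesOver_of_natCast_mem 7 _ h7
    rw [placesOver_eq_pair (p := 7) k1 k2 k17 k27] at hmem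
    simp only [Finset.mem_insert, Finset.mem_singleton] at hmem
    rcases hmem with h | h
    · have e : ord (Pt a c).F v (jInv (Pt a c).x) = -(2 * (c : ℤ)) := by
        have := ord_at_q1 hc k17 k1' ko1; rw [← h] at this; exact this
      rw [e]; exact hl2dvd c hlc
    · have e : ord (Pt a c).F v (jInv (Pt a c).x) = -(2 * (c : ℤ)) := by
        have := ord_at_q2 hc k27 k2 ko2; rw [← h] at this; exact this
      rw [e]; exact hl2dvd c hlc

/-- **(P5) at `P_{a,c}` for every prime `l ≠ 5`**: the pole `𝔭₁ ∣ 5` of `j(λ)` divides neither `2` nor `l`.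
[cite: Mochizuki2012, IUTchIV Cor 2.2 (ii) proof (P5) p.46] [claim: Mochizuki2012, status: disputed] -/
theorem condP5_P {l : ℕ} (hl : l.Prime) (hl5 : l ≠ 5) : CondP5 (Pt a c) l := by
  haveI : Fact (Nat.Prime 5) := ⟨by norm_num⟩
  obtain ⟨𝔭₁, -, -, -, ⟨h1, h1', h15, ho1⟩, -, -, -⟩ := exists_four_places ha hc
  have hv : 𝔭₁ ∈ placesOver (F a c) 5 := mem_placesOver_of_natCast_mem 5 𝔭₁ h15
  have hneg : ord (F a c) 𝔭₁ (jInv (lam a c)) < 0 := by rw [(ord_at_p1 hc h15 h1 h1' ho1).1]; omega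
  exact ⟨𝔭₁, hneg, SplitDepth.natCast_not_mem_of_prime_ne ⟨𝔭₁, hv⟩ Nat.prime_two (by norm_num),
    SplitDepth.natCast_not_mem_of_prime_ne ⟨𝔭₁, hv⟩ hl hl5⟩

/-! ## Heights: `log q^∀ ≥ a·log 5`, `log 𝔣 ≤ (log 5 + 2 log 7)/2`, `log-diff ≤ (log D)/2` -/

/-- **`a·log 5 ≤ log(q^∀(P_{a,c}))`** (the pole `𝔭₁` alone: `h_{𝔭₁} = 2a`, `log N(𝔭₁) = log 5`, `[F:ℚ] = 2`).
[cite: Mochizuki2012, IUTchIV Cor 2.2 (i) p.41] [claim: Mochizuki2012, status: disputed] -/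
theorem le_logQForall_P : (a : ℝ) * Real.log 5 ≤ logQForall (Pt a c) := by
  classical
  haveI : Fact (Nat.Prime 5) := ⟨by norm_num⟩
  obtain ⟨𝔭₁, 𝔭₂, -, -, ⟨h1, h1', h15, ho1⟩, ⟨h2, -, h25, -⟩, -, -⟩ := exists_four_places ha hc
  have hord : ord (Pt a c).F 𝔭₁ (jInv (Pt a c).x) = -(2 * (a : ℤ)) := (ord_at_p1 hc h15 h1 h1' ho1).1
  have hbad : 𝔭₁ ∈ badPlaces (Pt a c) := (mem_badPlaces_iff_ord_neg (Pt a c) 𝔭₁).mpr (by rw [hord]; omega)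
  have hmem : 𝔭₁ ∈ (badPlaces (Pt a c)).filter (fun v => ∀ p ∈ (∅ : Finset ℕ), ((p : ℕ) : 𝓞 (Pt a c).F) ∉ v.asIdeal) :=
    Finset.mem_filter.mpr ⟨hbad, fun p hp => absurd hp (Finset.notMem_empty p)⟩
  have hle : localHeight (Pt a c) 𝔭₁ * logNorm (Pt a c).F 𝔭₁ ≤ ((Pt a c).degree : ℝ) * logQForall (Pt a c) := by
    unfold logQForall
    rw [degree_mul_logQAvoid (Pt a c) ∅]
    exact Finset.single_le_sum (f := fun w => localHeight (Pt a c) w * logNorm (Pt a c).F w)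
      (fun w _ => mul_nonneg (localHeight_nonneg (Pt a c) w) (logNorm_pos (Pt a c).F w).le) hmem
  rw [localHeight_eq_neg_ord hbad, hord] at hle
  have hdeg : ((Pt a c).degree : ℝ) = 2 := by
    have : (Pt a c).degree = 2 := finrank_F a c
    rw [this]; norm_num
  have hlog : logNorm (Pt a c).F 𝔭₁ = Real.log 5 := (weight_pair_eq_half (p := 5) h1 h2 h15 h25).1.2
  rw [hdeg, hlog] at hle
  push_cast at hle
  linarith

omit ha in
/-- The bad places of `P_{a,c}` are among `𝔭₁, 𝔮₁, 𝔮₂`. [cite: Mochizuki2012, IUTchIV Cor 2.2 (ii) proof (P5) p.46]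
[claim: Mochizuki2012, status: disputed] -/
theorem badPlaces_subset {𝔭₁ 𝔭₂ 𝔮₁ 𝔮₂ : HeightOneSpectrum (𝓞 (F a c))}
    (H₁ : θI a c ∈ 𝔭₁.asIdeal ∧ θI' a c ∉ 𝔭₁.asIdeal ∧ ((5 : ℕ) : 𝓞 (F a c)) ∈ 𝔭₁.asIdeal ∧ ord (F a c) 𝔭₁ (5 : F a c) = 1)
    (H₂ : θI a c ∉ 𝔭₂.asIdeal ∧ θI' a c ∈ 𝔭₂.asIdeal ∧ ((5 : ℕ) : 𝓞 (F a c)) ∈ 𝔭₂.asIdeal ∧ ord (F a c) 𝔭₂ (5 : F a c) = 1)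
    (K₁ : θI a c ∈ 𝔮₁.asIdeal ∧ θI' a c ∉ 𝔮₁.asIdeal ∧ ((7 : ℕ) : 𝓞 (F a c)) ∈ 𝔮₁.asIdeal ∧ ord (F a c) 𝔮₁ (7 : F a c) = 1)
    (K₂ : θI a c ∉ 𝔮₂.asIdeal ∧ θI' a c ∈ 𝔮₂.asIdeal ∧ ((7 : ℕ) : 𝓞 (F a c)) ∈ 𝔮₂.asIdeal ∧ ord (F a c) 𝔮₂ (7 : F a c) = 1) :
    ∀ v ∈ badPlaces (Pt a c), (v : HeightOneSpectrum (𝓞 (F a c))) = 𝔭₁ ∨ v = 𝔮₁ ∨ v = 𝔮₂ := by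
  classical
  haveI : Fact (Nat.Prime 5) := ⟨by norm_num⟩
  haveI : Fact (Nat.Prime 7) := ⟨by norm_num⟩
  intro v hv
  rw [mem_badPlaces_iff_ord_neg] at hv
  have hv' : ord (F a c) (v : HeightOneSpectrum (𝓞 (F a c))) (jInv (lam a c)) < 0 := hv
  rcases five_mem_or_seven_mem_of_ord_neg hc hv' with h5 | h7
  · have hmem : (v : HeightOneSpectrum (𝓞 (F a c))) ∈ placesOver (F a c) 5 := mem_placesOver_of_natCast_mem 5 _ h5
    rw [placesOver_eq_pair (p := 5) H₁.1 H₂.1 H₁.2.2.1 H₂.2.2.1] at hmem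
    simp only [Finset.mem_insert, Finset.mem_singleton] at hmem
    rcases hmem with h | h
    · exact Or.inl h
    · have e : 0 ≤ ord (F a c) (v : HeightOneSpectrum (𝓞 (F a c))) (jInv (lam a c)) := by
        rw [h]; exact (ord_at_p2 hc H₂.2.2.1 H₂.1).1
      exact absurd e (not_le.mpr hv')
  · have hmem : (v : HeightOneSpectrum (𝓞 (F a c))) ∈ placesOver (F a c) 7 := mem_placesOver_of_natCast_mem 7 _ h7
    rw [placesOver_eq_pair (p := 7) K₁.1 K₂.1 K₁.2.2.1 K₂.2.2.1] at hmem
    simp only [Finset.mem_insert, Finset.mem_singleton] at hmem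
    rcases hmem with h | h
    · exact Or.inr (Or.inl h)
    · exact Or.inr (Or.inr h)

/-- **`log 𝔣^{F_tpd}_{∤S}(P_{a,c}) ≤ (log 5 + 2·log 7)/2`** for every `S` (the conductor is CONSTANT along the family).
[cite: Mochizuki2012, IUTchIV Thm 1.10 p.23] [claim: Mochizuki2012, status: disputed] -/
theorem logCondAvoid_le (S : Finset ℕ) : logCondAvoid (Pt a c) S ≤ (Real.log 5 + 2 * Real.log 7) / 2 := by
  classical
  haveI : Fact (Nat.Prime 5) := ⟨by norm_num⟩
  haveI : Fact (Nat.Prime 7) := ⟨by norm_num⟩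
  obtain ⟨𝔭₁, 𝔭₂, 𝔮₁, 𝔮₂, H₁, H₂, K₁, K₂⟩ := exists_four_places ha hc
  have hsub := badPlaces_subset hc H₁ H₂ K₁ K₂
  rw [logCondAvoid_eq_sum]
  have hdeg : ((Pt a c).degree : ℝ) = 2 := by
    have : (Pt a c).degree = 2 := finrank_F a c
    rw [this]; norm_num
  rw [hdeg]
  -- the three places are distinct
  have h57 : 𝔭₁ ≠ 𝔮₁ ∧ 𝔭₁ ≠ 𝔮₂ := by
    have h7 : ((7 : ℕ) : 𝓞 (F a c)) ∉ 𝔭₁.asIdeal :=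
      SplitDepth.natCast_not_mem_of_prime_ne ⟨𝔭₁, mem_placesOver_of_natCast_mem 5 𝔭₁ H₁.2.2.1⟩ (by norm_num) (by norm_num)
    exact ⟨fun h => h7 (h ▸ K₁.2.2.1), fun h => h7 (h ▸ K₂.2.2.1)⟩
  have hqq : 𝔮₁ ≠ 𝔮₂ := fun h => K₂.1 (h ▸ K₁.1)
  let T : Finset (HeightOneSpectrum (𝓞 (Pt a c).F)) := {𝔭₁, 𝔮₁, 𝔮₂}
  have hsub' : badPlacesAvoid (Pt a c) S ⊆ T := by
    intro v hv
    have hv' := hsub v (Finset.mem_of_mem_filter v hv)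
    change v ∈ ({𝔭₁, 𝔮₁, 𝔮₂} : Finset _)
    simp only [Finset.mem_insert, Finset.mem_singleton]
    exact hv'
  have hnn : ∀ v ∈ T, v ∉ badPlacesAvoid (Pt a c) S → 0 ≤ Real.log (Ideal.absNorm v.asIdeal : ℝ) :=
    fun v _ _ => (logNorm_pos (Pt a c).F v).le
  have hle := Finset.sum_le_sum_of_subset_of_nonneg hsub' hnn
  have hT : ∑ v ∈ T, Real.log (Ideal.absNorm v.asIdeal : ℝ) = Real.log 5 + (Real.log 7 + Real.log 7) := by
    change ∑ v ∈ ({𝔭₁, 𝔮₁, 𝔮₂} : Finset _), Real.log (Ideal.absNorm v.asIdeal : ℝ) = _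
    rw [Finset.sum_insert (by simp [h57.1, h57.2]), Finset.sum_pair hqq]
    have e5 : logNorm (F a c) 𝔭₁ = Real.log 5 := (weight_pair_eq_half (p := 5) H₁.1 H₂.1 H₁.2.2.1 H₂.2.2.1).1.2
    have e7 := weight_pair_eq_half (p := 7) K₁.1 K₂.1 K₁.2.2.1 K₂.2.2.1
    unfold logNorm at e5 e7
    rw [e5, e7.1.2, e7.2.2]; push_cast; ring
  rw [hT] at hle
  have : (2 : ℝ)⁻¹ * ∑ v ∈ badPlacesAvoid (Pt a c) S, Real.log (Ideal.absNorm v.asIdeal : ℝ) ≤ 2⁻¹ * (Real.log 5 + (Real.log 7 + Real.log 7)) :=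
    mul_le_mul_of_nonneg_left hle (by norm_num)
  linarith

omit ha hc in
/-- `δ = 2θ − s` as an algebraic integer, and `δ ∈ 𝔡_{F/ℚ}` (Dedekind: `f′(θ) ∈ 𝔡` for the integer `θ` with `F = ℚ(θ)`, `f = X² − sX + 5^a7^c`).
[cite: NeukirchANT1999, Ch. III §2] -/
theorem δ_mem_differentIdeal : (2 * θI a c - ((s a c : ℕ) : 𝓞 (F a c))) ∈ differentIdeal ℤ (𝓞 (F a c)) := by
  -- `g = X² − sX + P` kills `θ`, so `minpoly ℤ θ ∣ g` and `g′(θ) ∈ (minpoly′(θ)) ⊆ 𝔡`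
  set g : ℤ[X] := X ^ 2 - C (s a c : ℤ) * X + C ((5 ^ a * 7 ^ c : ℕ) : ℤ) with hg
  have hgθ : aeval (θI a c) g = 0 := by
    apply RingOfIntegers.coe_injective
    have h := θ_sq_sub a c
    rw [hg]
    simp only [map_add, map_sub, map_mul, map_pow, aeval_X, map_natCast, map_zero]
    have e : algebraMap (𝓞 (F a c)) (F a c) (θI a c) = θ a c := rfl
    rw [e]
    push_cast at h ⊢
    linear_combination h
  have hdvd : minpoly ℤ (θI a c) ∣ g := minpoly.isIntegrallyClosed_dvd (RingOfIntegers.isIntegral (θI a c)) hgθ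
  obtain ⟨h, hh⟩ := hdvd
  have hder : aeval (θI a c) (derivative g) = aeval (θI a c) (derivative (minpoly ℤ (θI a c))) * aeval (θI a c) h := by
    rw [hh, derivative_mul, map_add, map_mul, map_mul, minpoly.aeval, zero_mul, add_zero]
  have hx : Algebra.adjoin ℚ {algebraMap (𝓞 (F a c)) (F a c) (θI a c)} = ⊤ := by
    change Algebra.adjoin ℚ {θ a c} = ⊤
    refine top_le_iff.mp ((AdjoinRoot.adjoinRoot_eq_top (R := ℚ) (f := fpoly a c)).symm.trans_le (Algebra.adjoin_le ?_))
    rintro x hx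
    rw [Set.mem_singleton_iff] at hx
    subst hx
    have : AdjoinRoot.root (fpoly a c) = 2 * θ a c - (s a c : F a c) := by
      change δ a c = _; unfold θ; ring
    rw [this]
    refine Subalgebra.sub_mem _ (Subalgebra.mul_mem _ ?_ (Algebra.self_mem_adjoin_singleton ℚ (θ a c))) ?_
    · exact Subalgebra.natCast_mem _ 2
    · exact Subalgebra.natCast_mem _ (s a c)
  have hmem := aeval_derivative_mem_differentIdeal ℤ ℚ (F a c) (θI a c) hx
  have hd : derivative g = C (2 : ℤ) * X - C (s a c : ℤ) := by
    rw [hg, derivative_add, derivative_sub, derivative_X_pow, derivative_C, add_zero, derivative_mul, derivative_C, zero_mul,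
      derivative_X, zero_add, mul_one]
    simp
  have hg' : aeval (θI a c) (derivative g) = 2 * θI a c - ((s a c : ℕ) : 𝓞 (F a c)) := by
    rw [hd, map_sub, map_mul, aeval_C, aeval_C, aeval_X, algebraMap_int_eq, eq_intCast, eq_intCast, Int.cast_natCast]
    push_cast; ring
  rw [← hg', hder]
  exact Ideal.mul_mem_right _ _ hmem

omit ha hc in
/-- **`log-diff(P_{a,c}) ≤ (log D)/2`**, `D = 5^{2a} + 4·7^{2c}`: `N(𝔡_F) ∣ |N(δ)| = D`. [cite: MochizukiGenEll2010, Def 1.5 (iii) p.8] -/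
theorem logDiff_le : (Pt a c).logDiff ≤ Real.log (D a c) / 2 := by
  set δI : 𝓞 (F a c) := 2 * θI a c - ((s a c : ℕ) : 𝓞 (F a c)) with hδI
  have hδ : ((δI : 𝓞 (F a c)) : F a c) = δ a c := by
    rw [hδI, RingOfIntegers.coe_eq_algebraMap, map_sub, map_mul, map_natCast, map_ofNat]
    have e : algebraMap (𝓞 (F a c)) (F a c) (θI a c) = θ a c := rfl
    rw [e]; unfold θ; ring
  -- `|N(δ)| = D`
  have hnorm : (Algebra.norm ℤ δI).natAbs = D a c := by
    have h1 : ((Algebra.norm ℤ δI : ℤ) : ℚ) ^ 2 = ((D a c : ℕ) : ℚ) ^ 2 := by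
      rw [Algebra.coe_norm_int, hδ, ← map_pow, δ_sq, show ((D a c : ℕ) : F a c) = algebraMap ℚ (F a c) (D a c) by simp,
        Algebra.norm_algebraMap, finrank_F]
    have h2 : ((Algebra.norm ℤ δI : ℤ)) ^ 2 = ((D a c : ℕ) : ℤ) ^ 2 := by exact_mod_cast h1
    rcases sq_eq_sq_iff_eq_or_eq_neg.mp h2 with h | h
    · rw [h]; simp
    · rw [h]; simp
  have hle : Ideal.absNorm (differentIdeal ℤ (𝓞 (F a c))) ≤ D a c := by
    have hdvd := Ideal.absNorm_dvd_absNorm_of_le ((Ideal.span_singleton_le_iff_mem _).mpr (δ_mem_differentIdeal (a := a) (c := c)))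
    rw [Ideal.absNorm_span_singleton, hnorm] at hdvd
    exact Nat.le_of_dvd (by unfold D; positivity) hdvd
  have hpos : 0 < Ideal.absNorm (differentIdeal ℤ (𝓞 (F a c))) := by
    rw [Nat.pos_iff_ne_zero, Ne, Ideal.absNorm_eq_zero_iff]
    exact differentIdeal_ne_bot
  unfold NFPoint.logDiff
  have hdeg : ((Pt a c).degree : ℝ) = 2 := by
    have : (Pt a c).degree = 2 := finrank_F a c
    rw [this]; norm_num
  rw [hdeg]
  have := Real.log_le_log (by exact_mod_cast hpos) (by exact_mod_cast hle : (Ideal.absNorm (differentIdeal ℤ (𝓞 (F a c))) : ℝ) ≤ D a c)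
  change (2 : ℝ)⁻¹ * Real.log (Ideal.absNorm (differentIdeal ℤ (𝓞 (F a c))) : ℝ) ≤ _
  linarith

/-! ## The conjugates of `λ` and membership in `K_∞(R)` -/

omit ha hc in
/-- Every complex conjugate of `λ` is a root of `z² − (2 + r)z + r`, `r = 5^a/7^c`. [cite: MochizukiGenEll2010, Ex 1.3 (ii) p.5] -/
theorem emb_lam_root (τ : F a c →+* ℂ) :
    (τ (lam a c)) ^ 2 - (2 + (((5 : ℝ) ^ a / (7 : ℝ) ^ c : ℝ) : ℂ)) * τ (lam a c) + (((5 : ℝ) ^ a / (7 : ℝ) ^ c : ℝ) : ℂ) = 0 := by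
  have h1 := lam_add_lam' a c
  have h2 := lam_mul_lam' a c
  have key : lam a c ^ 2 - (2 + (5 : F a c) ^ a / (7 : F a c) ^ c) * lam a c + (5 : F a c) ^ a / (7 : F a c) ^ c = 0 := by
    rw [← h1, ← h2]; ring
  have := congrArg τ key
  simp only [map_add, map_sub, map_zero, map_mul, map_pow, map_div₀, map_ofNat] at this
  push_cast
  exact this

omit ha hc in
/-- **`P_{a,c} ∈ K_∞(R)`** whenever `7^c ≤ 5^a ≤ R·7^c`. [cite: MochizukiGenEll2010, Ex 1.3 (ii) p.5] -/
theorem P_mem_cbTwoDiscs {R : ℝ} (hR : 1 ≤ R) (hlo : (7 : ℝ) ^ c ≤ (5 : ℝ) ^ a) (hhi : (5 : ℝ) ^ a ≤ R * (7 : ℝ) ^ c) :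
    Pt a c ∈ (cbTwoDiscs R hR).toSet := by
  have h7 : (0 : ℝ) < (7 : ℝ) ^ c := by positivity
  have hr : 1 ≤ (5 : ℝ) ^ a / (7 : ℝ) ^ c := by rw [le_div_iff₀ h7]; linarith
  have hrR : (5 : ℝ) ^ a / (7 : ℝ) ^ c ≤ R := by rw [div_le_iff₀ h7]; exact hhi
  refine ⟨fun τ => ?_, fun p hp => absurd hp (by simp)⟩
  change τ (lam a c) ∈ twoDiscs R
  exact root_mem_twoDiscs hr hrR (emb_lam_root τ)

end Point

end Summit.ABC.IUTFork.SUnitFamily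

end
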